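import Summits.MatrixMultiplication.MatrixMultiplication.Theses.AbelianSTPPCensus
import Summits.MatrixMultiplication.MatrixMultiplication.Theorems.AbelianSTPPCensusShapeCertFinal

/-!
# Route `AbelianSTPPCensus`, crux `ShapeExclusionTE` — closed (cell mm-stpp, rung F-M1.T_E/127)

The route item `ShapeExclusionTE` (stmt-MatrixMultiplication-19759) is literally the statement proved by
`Summit.MatrixMultiplication.MatrixMultiplication.Theorems.shapeExclusionTE_holds`
(file `…Theorems.AbelianSTPPCensusShapeCertFinal`: the verified certificate checker `ShapeCert.check`, its
soundness theorem `ShapeCert.check_sound`, and the kernel evaluations `ShapeCert.check_le_127`; lineage B,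
seat eng-2).
-/

set_option linter.dupNamespace false -- `MatrixMultiplication.MatrixMultiplication` (summit = problem, D-0017)

namespace Summit.MatrixMultiplication.MatrixMultiplication.Theorems

/-- **Crux `ShapeExclusionTE` of route `AbelianSTPPCensus`**: every shape list with at least two members that
satisfies the sieve system `SieveAdmissible M` and beats `5/2` at an order `M ≤ 127` has
`M ∈ {111, 120, 121, 124, 125, 126, 127}` and contains one of the registered residual sub-multisets. -/
theorem ShapeExclusionTE_proof :
    Summit.MatrixMultiplication.MatrixMultiplication.Theses.AbelianSTPPCensus.ShapeExclusionTE :=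
  shapeExclusionTE_holds

end Summit.MatrixMultiplication.MatrixMultiplication.Theorems
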